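import Summits.Ventures.QEC.Census.CSS.UpperFromAdditive
import Summits.Ventures.QEC.Census.LPBounds.NoCodeK14To18
import HarnessLib

/-!
# CSS table cells `13 ≤ n ≤ 16`, UPPER column from the additive bounds (29 cells)

Continuation of `Census/CSS/UpperFromAdditive.lean` / `UpperFromAdditiveN09to12.lean` (LADDER-QEC, CENSUS-PREREG C.2; see
the first file's docstring) to qec-search-5 g2's COMPUTED extension table census/search-5/css-n16/CSS-CALIB.tsv (kit j268614,
cells `13 ≤ n ≤ 16`: LOWER = explicit CSS instance, UPPER = exact-rational CSS-LP value `u`). For each of the 29 cells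
`(n, k)` of that range where `u + 1` is exactly the distance excluded by qec-type-06's unconditional KERNEL-std theorem
`noCode_n_k : ¬ AdditiveCodeExists n k (u+1)` (Census/LPBounds/NoCodeK*.lean, CRSS Thm. 21 LP), every CSS code on `n` qubits
with `k` logical qubits has `min (d^X, d^Z) ≤ u` (`k ≥ 1`) / a nonzero stabilizer of weight `≤ u` (`k = 0`, CRSS
convention), through `css_min_dX_dZ_lt_of_not_additiveCodeExists` / `css_exists_stabilizer_lt_of_not_additiveCodeExists`.
The other 33 cells of the range (CSS-LP strictly below the additive bound) are `Census/CSS/UpperLPN13to16P*.lean`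
(Farkas certificates). HONEST FRAMING: with the LOWER column (`Census/CSS/CalibCSSN1*.lean`, `CalibCSSK0N13to16.lean`) a
cell is a theorem in BOTH columns exactly when it is CLOSED in search-5's table; of the cells in this file (13,3), (15,1) and
(16,0) are OPEN there (instance `u − 1`, bound `u`; said again in their docstrings) — the kernel does not decide them.
[folklore]; bounds = CRSS Table III (additive) LP column as proved by qec-type-06 [cite: CalderbankEtAl1998, §8 Table III
(printed pp. 32–34)].
-/

namespace Summit.Ventures.QEC.Census.CSS

open Summit.Ventures.QEC.Census Summit.Ventures.QEC.Census.NoCode Literature.InformationTheory.QuantumCodes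


/-- Cell `(n, k) = (13, 2)`: every CSS code on `13` qubits with `k = 2` has `min (d^X, d^Z) ≤ 4` — the css-n16 value `4` is optimal among CSS codes because it is optimal among all additive codes (`noCode_13_2 : ¬ [[13,2,5]]`). [folklore] -/
theorem cssUpper_13_2 {RX RZ : Type*} [Fintype RX] [Fintype RZ] (C : CSSCode RX RZ (Fin 13)) (hk : C.k = 2) :
    min C.dX C.dZ ≤ 4 :=
  Nat.lt_succ_iff.1 (css_min_dX_dZ_lt_of_not_additiveCodeExists noCode_13_2 C hk)

/-- Cell `(n, k) = (13, 3)`: every CSS code on `13` qubits with `k = 3` has `min (d^X, d^Z) ≤ 4` — OPEN cell of the css-n16 table (best CSS instance `3`, CSS-LP `4`): this is the bound `4`, which coincides with the additive bound (`noCode_13_3 : ¬ [[13,3,5]]`). [folklore] -/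
theorem cssUpper_13_3 {RX RZ : Type*} [Fintype RX] [Fintype RZ] (C : CSSCode RX RZ (Fin 13)) (hk : C.k = 3) :
    min C.dX C.dZ ≤ 4 :=
  Nat.lt_succ_iff.1 (css_min_dX_dZ_lt_of_not_additiveCodeExists noCode_13_3 C hk)

/-- Cell `(n, k) = (13, 8)`: every CSS code on `13` qubits with `k = 8` has `min (d^X, d^Z) ≤ 2` — the css-n16 value `2` is optimal among CSS codes because it is optimal among all additive codes (`noCode_13_8 : ¬ [[13,8,3]]`). [folklore] -/
theorem cssUpper_13_8 {RX RZ : Type*} [Fintype RX] [Fintype RZ] (C : CSSCode RX RZ (Fin 13)) (hk : C.k = 8) :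
    min C.dX C.dZ ≤ 2 :=
  Nat.lt_succ_iff.1 (css_min_dX_dZ_lt_of_not_additiveCodeExists noCode_13_8 C hk)

/-- Cell `(n, k) = (13, 9)`: every CSS code on `13` qubits with `k = 9` has `min (d^X, d^Z) ≤ 2` — the css-n16 value `2` is optimal among CSS codes because it is optimal among all additive codes (`noCode_13_9 : ¬ [[13,9,3]]`). [folklore] -/
theorem cssUpper_13_9 {RX RZ : Type*} [Fintype RX] [Fintype RZ] (C : CSSCode RX RZ (Fin 13)) (hk : C.k = 9) :
    min C.dX C.dZ ≤ 2 :=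
  Nat.lt_succ_iff.1 (css_min_dX_dZ_lt_of_not_additiveCodeExists noCode_13_9 C hk)

/-- Cell `(n, k) = (13, 10)`: every CSS code on `13` qubits with `k = 10` has `min (d^X, d^Z) ≤ 2` — the css-n16 value `2` is optimal among CSS codes because it is optimal among all additive codes (`noCode_13_10 : ¬ [[13,10,3]]`). [folklore] -/
theorem cssUpper_13_10 {RX RZ : Type*} [Fintype RX] [Fintype RZ] (C : CSSCode RX RZ (Fin 13)) (hk : C.k = 10) :
    min C.dX C.dZ ≤ 2 :=
  Nat.lt_succ_iff.1 (css_min_dX_dZ_lt_of_not_additiveCodeExists noCode_13_10 C hk)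

/-- Cell `(n, k) = (13, 11)`: every CSS code on `13` qubits with `k = 11` has `min (d^X, d^Z) ≤ 1` — the css-n16 value `1` is optimal among CSS codes because it is optimal among all additive codes (`noCode_13_11 : ¬ [[13,11,2]]`). [folklore] -/
theorem cssUpper_13_11 {RX RZ : Type*} [Fintype RX] [Fintype RZ] (C : CSSCode RX RZ (Fin 13)) (hk : C.k = 11) :
    min C.dX C.dZ ≤ 1 :=
  Nat.lt_succ_iff.1 (css_min_dX_dZ_lt_of_not_additiveCodeExists noCode_13_11 C hk)

/-- Cell `(n, k) = (13, 12)`: every CSS code on `13` qubits with `k = 12` has `min (d^X, d^Z) ≤ 1` — the css-n16 value `1` is optimal among CSS codes because it is optimal among all additive codes (`noCode_13_12 : ¬ [[13,12,2]]`). [folklore] -/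
theorem cssUpper_13_12 {RX RZ : Type*} [Fintype RX] [Fintype RZ] (C : CSSCode RX RZ (Fin 13)) (hk : C.k = 12) :
    min C.dX C.dZ ≤ 1 :=
  Nat.lt_succ_iff.1 (css_min_dX_dZ_lt_of_not_additiveCodeExists noCode_13_12 C hk)

/-- Cell `(n, k) = (13, 13)`: every CSS code on `13` qubits with `k = 13` has `min (d^X, d^Z) ≤ 1` — the css-n16 value `1` is optimal among CSS codes because it is optimal among all additive codes (`noCode_13_13 : ¬ [[13,13,2]]`). [folklore] -/
theorem cssUpper_13_13 {RX RZ : Type*} [Fintype RX] [Fintype RZ] (C : CSSCode RX RZ (Fin 13)) (hk : C.k = 13) :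
    min C.dX C.dZ ≤ 1 :=
  Nat.lt_succ_iff.1 (css_min_dX_dZ_lt_of_not_additiveCodeExists noCode_13_13 C hk)

/-- Cell `(n, k) = (14, 9)`: every CSS code on `14` qubits with `k = 9` has `min (d^X, d^Z) ≤ 2` — the css-n16 value `2` is optimal among CSS codes because it is optimal among all additive codes (`noCode_14_9 : ¬ [[14,9,3]]`). [folklore] -/
theorem cssUpper_14_9 {RX RZ : Type*} [Fintype RX] [Fintype RZ] (C : CSSCode RX RZ (Fin 14)) (hk : C.k = 9) :
    min C.dX C.dZ ≤ 2 :=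
  Nat.lt_succ_iff.1 (css_min_dX_dZ_lt_of_not_additiveCodeExists noCode_14_9 C hk)

/-- Cell `(n, k) = (14, 10)`: every CSS code on `14` qubits with `k = 10` has `min (d^X, d^Z) ≤ 2` — the css-n16 value `2` is optimal among CSS codes because it is optimal among all additive codes (`noCode_14_10 : ¬ [[14,10,3]]`). [folklore] -/
theorem cssUpper_14_10 {RX RZ : Type*} [Fintype RX] [Fintype RZ] (C : CSSCode RX RZ (Fin 14)) (hk : C.k = 10) :
    min C.dX C.dZ ≤ 2 :=
  Nat.lt_succ_iff.1 (css_min_dX_dZ_lt_of_not_additiveCodeExists noCode_14_10 C hk)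

/-- Cell `(n, k) = (14, 11)`: every CSS code on `14` qubits with `k = 11` has `min (d^X, d^Z) ≤ 2` — the css-n16 value `2` is optimal among CSS codes because it is optimal among all additive codes (`noCode_14_11 : ¬ [[14,11,3]]`). [folklore] -/
theorem cssUpper_14_11 {RX RZ : Type*} [Fintype RX] [Fintype RZ] (C : CSSCode RX RZ (Fin 14)) (hk : C.k = 11) :
    min C.dX C.dZ ≤ 2 :=
  Nat.lt_succ_iff.1 (css_min_dX_dZ_lt_of_not_additiveCodeExists noCode_14_11 C hk)

/-- Cell `(n, k) = (14, 12)`: every CSS code on `14` qubits with `k = 12` has `min (d^X, d^Z) ≤ 2` — the css-n16 value `2` is optimal among CSS codes because it is optimal among all additive codes (`noCode_14_12 : ¬ [[14,12,3]]`). [folklore] -/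
theorem cssUpper_14_12 {RX RZ : Type*} [Fintype RX] [Fintype RZ] (C : CSSCode RX RZ (Fin 14)) (hk : C.k = 12) :
    min C.dX C.dZ ≤ 2 :=
  Nat.lt_succ_iff.1 (css_min_dX_dZ_lt_of_not_additiveCodeExists noCode_14_12 C hk)

/-- Cell `(n, k) = (14, 13)`: every CSS code on `14` qubits with `k = 13` has `min (d^X, d^Z) ≤ 1` — the css-n16 value `1` is optimal among CSS codes because it is optimal among all additive codes (`noCode_14_13 : ¬ [[14,13,2]]`). [folklore] -/
theorem cssUpper_14_13 {RX RZ : Type*} [Fintype RX] [Fintype RZ] (C : CSSCode RX RZ (Fin 14)) (hk : C.k = 13) :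
    min C.dX C.dZ ≤ 1 :=
  Nat.lt_succ_iff.1 (css_min_dX_dZ_lt_of_not_additiveCodeExists noCode_14_13 C hk)

/-- Cell `(n, k) = (14, 14)`: every CSS code on `14` qubits with `k = 14` has `min (d^X, d^Z) ≤ 1` — the css-n16 value `1` is optimal among CSS codes because it is optimal among all additive codes (`noCode_14_14 : ¬ [[14,14,2]]`). [folklore] -/
theorem cssUpper_14_14 {RX RZ : Type*} [Fintype RX] [Fintype RZ] (C : CSSCode RX RZ (Fin 14)) (hk : C.k = 14) :
    min C.dX C.dZ ≤ 1 :=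
  Nat.lt_succ_iff.1 (css_min_dX_dZ_lt_of_not_additiveCodeExists noCode_14_14 C hk)

/-- Cell `(n, k) = (15, 1)`: every CSS code on `15` qubits with `k = 1` has `min (d^X, d^Z) ≤ 5` — OPEN cell of the css-n16 table (best CSS instance `4`, CSS-LP `5`): this is the bound `5`, which coincides with the additive bound (`noCode_15_1 : ¬ [[15,1,6]]`). [folklore] -/
theorem cssUpper_15_1 {RX RZ : Type*} [Fintype RX] [Fintype RZ] (C : CSSCode RX RZ (Fin 15)) (hk : C.k = 1) :
    min C.dX C.dZ ≤ 5 :=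
  Nat.lt_succ_iff.1 (css_min_dX_dZ_lt_of_not_additiveCodeExists noCode_15_1 C hk)

/-- Cell `(n, k) = (15, 10)`: every CSS code on `15` qubits with `k = 10` has `min (d^X, d^Z) ≤ 2` — the css-n16 value `2` is optimal among CSS codes because it is optimal among all additive codes (`noCode_15_10 : ¬ [[15,10,3]]`). [folklore] -/
theorem cssUpper_15_10 {RX RZ : Type*} [Fintype RX] [Fintype RZ] (C : CSSCode RX RZ (Fin 15)) (hk : C.k = 10) :
    min C.dX C.dZ ≤ 2 :=
  Nat.lt_succ_iff.1 (css_min_dX_dZ_lt_of_not_additiveCodeExists noCode_15_10 C hk)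

/-- Cell `(n, k) = (15, 11)`: every CSS code on `15` qubits with `k = 11` has `min (d^X, d^Z) ≤ 2` — the css-n16 value `2` is optimal among CSS codes because it is optimal among all additive codes (`noCode_15_11 : ¬ [[15,11,3]]`). [folklore] -/
theorem cssUpper_15_11 {RX RZ : Type*} [Fintype RX] [Fintype RZ] (C : CSSCode RX RZ (Fin 15)) (hk : C.k = 11) :
    min C.dX C.dZ ≤ 2 :=
  Nat.lt_succ_iff.1 (css_min_dX_dZ_lt_of_not_additiveCodeExists noCode_15_11 C hk)

/-- Cell `(n, k) = (15, 12)`: every CSS code on `15` qubits with `k = 12` has `min (d^X, d^Z) ≤ 2` — the css-n16 value `2` is optimal among CSS codes because it is optimal among all additive codes (`noCode_15_12 : ¬ [[15,12,3]]`). [folklore] -/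
theorem cssUpper_15_12 {RX RZ : Type*} [Fintype RX] [Fintype RZ] (C : CSSCode RX RZ (Fin 15)) (hk : C.k = 12) :
    min C.dX C.dZ ≤ 2 :=
  Nat.lt_succ_iff.1 (css_min_dX_dZ_lt_of_not_additiveCodeExists noCode_15_12 C hk)

/-- Cell `(n, k) = (15, 13)`: every CSS code on `15` qubits with `k = 13` has `min (d^X, d^Z) ≤ 1` — the css-n16 value `1` is optimal among CSS codes because it is optimal among all additive codes (`noCode_15_13 : ¬ [[15,13,2]]`). [folklore] -/
theorem cssUpper_15_13 {RX RZ : Type*} [Fintype RX] [Fintype RZ] (C : CSSCode RX RZ (Fin 15)) (hk : C.k = 13) :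
    min C.dX C.dZ ≤ 1 :=
  Nat.lt_succ_iff.1 (css_min_dX_dZ_lt_of_not_additiveCodeExists noCode_15_13 C hk)

/-- Cell `(n, k) = (15, 14)`: every CSS code on `15` qubits with `k = 14` has `min (d^X, d^Z) ≤ 1` — the css-n16 value `1` is optimal among CSS codes because it is optimal among all additive codes (`noCode_15_14 : ¬ [[15,14,2]]`). [folklore] -/
theorem cssUpper_15_14 {RX RZ : Type*} [Fintype RX] [Fintype RZ] (C : CSSCode RX RZ (Fin 15)) (hk : C.k = 14) :
    min C.dX C.dZ ≤ 1 :=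
  Nat.lt_succ_iff.1 (css_min_dX_dZ_lt_of_not_additiveCodeExists noCode_15_14 C hk)

/-- Cell `(n, k) = (15, 15)`: every CSS code on `15` qubits with `k = 15` has `min (d^X, d^Z) ≤ 1` — the css-n16 value `1` is optimal among CSS codes because it is optimal among all additive codes (`noCode_15_15 : ¬ [[15,15,2]]`). [folklore] -/
theorem cssUpper_15_15 {RX RZ : Type*} [Fintype RX] [Fintype RZ] (C : CSSCode RX RZ (Fin 15)) (hk : C.k = 15) :
    min C.dX C.dZ ≤ 1 :=
  Nat.lt_succ_iff.1 (css_min_dX_dZ_lt_of_not_additiveCodeExists noCode_15_15 C hk)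

/-- Cell `(n, k) = (16, 0)`: every zero-rate CSS code on `16` qubits has a nonzero stabilizer of weight `≤ 6` (CRSS `k = 0`
convention) — OPEN cell of the css-n16 table (best CSS instance `5`, CSS-LP `6`): this is the bound `6`, which coincides with the additive bound (`noCode_16_0 : ¬ [[16,0,7]]`). [folklore] -/
theorem cssUpper_16_0 {RX RZ : Type*} [Fintype RX] [Fintype RZ] (C : CSSCode RX RZ (Fin 16)) (hk : C.k = 0) :
    ∃ v ∈ C.toSympCode, v ≠ 0 ∧ sympWeight v ≤ 6 := by
  obtain ⟨v, hv, hv0, hlt⟩ := css_exists_stabilizer_lt_of_not_additiveCodeExists noCode_16_0 C hk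
  exact ⟨v, hv, hv0, Nat.lt_succ_iff.1 hlt⟩

/-- Cell `(n, k) = (16, 6)`: every CSS code on `16` qubits with `k = 6` has `min (d^X, d^Z) ≤ 4` — the css-n16 value `4` is optimal among CSS codes because it is optimal among all additive codes (`noCode_16_6 : ¬ [[16,6,5]]`). [folklore] -/
theorem cssUpper_16_6 {RX RZ : Type*} [Fintype RX] [Fintype RZ] (C : CSSCode RX RZ (Fin 16)) (hk : C.k = 6) :
    min C.dX C.dZ ≤ 4 :=
  Nat.lt_succ_iff.1 (css_min_dX_dZ_lt_of_not_additiveCodeExists noCode_16_6 C hk)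

/-- Cell `(n, k) = (16, 11)`: every CSS code on `16` qubits with `k = 11` has `min (d^X, d^Z) ≤ 2` — the css-n16 value `2` is optimal among CSS codes because it is optimal among all additive codes (`noCode_16_11 : ¬ [[16,11,3]]`). [folklore] -/
theorem cssUpper_16_11 {RX RZ : Type*} [Fintype RX] [Fintype RZ] (C : CSSCode RX RZ (Fin 16)) (hk : C.k = 11) :
    min C.dX C.dZ ≤ 2 :=
  Nat.lt_succ_iff.1 (css_min_dX_dZ_lt_of_not_additiveCodeExists noCode_16_11 C hk)

/-- Cell `(n, k) = (16, 12)`: every CSS code on `16` qubits with `k = 12` has `min (d^X, d^Z) ≤ 2` — the css-n16 value `2` is optimal among CSS codes because it is optimal among all additive codes (`noCode_16_12 : ¬ [[16,12,3]]`). [folklore] -/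
theorem cssUpper_16_12 {RX RZ : Type*} [Fintype RX] [Fintype RZ] (C : CSSCode RX RZ (Fin 16)) (hk : C.k = 12) :
    min C.dX C.dZ ≤ 2 :=
  Nat.lt_succ_iff.1 (css_min_dX_dZ_lt_of_not_additiveCodeExists noCode_16_12 C hk)

/-- Cell `(n, k) = (16, 13)`: every CSS code on `16` qubits with `k = 13` has `min (d^X, d^Z) ≤ 2` — the css-n16 value `2` is optimal among CSS codes because it is optimal among all additive codes (`noCode_16_13 : ¬ [[16,13,3]]`). [folklore] -/
theorem cssUpper_16_13 {RX RZ : Type*} [Fintype RX] [Fintype RZ] (C : CSSCode RX RZ (Fin 16)) (hk : C.k = 13) :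
    min C.dX C.dZ ≤ 2 :=
  Nat.lt_succ_iff.1 (css_min_dX_dZ_lt_of_not_additiveCodeExists noCode_16_13 C hk)

/-- Cell `(n, k) = (16, 14)`: every CSS code on `16` qubits with `k = 14` has `min (d^X, d^Z) ≤ 2` — the css-n16 value `2` is optimal among CSS codes because it is optimal among all additive codes (`noCode_16_14 : ¬ [[16,14,3]]`). [folklore] -/
theorem cssUpper_16_14 {RX RZ : Type*} [Fintype RX] [Fintype RZ] (C : CSSCode RX RZ (Fin 16)) (hk : C.k = 14) :
    min C.dX C.dZ ≤ 2 :=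
  Nat.lt_succ_iff.1 (css_min_dX_dZ_lt_of_not_additiveCodeExists noCode_16_14 C hk)

/-- Cell `(n, k) = (16, 15)`: every CSS code on `16` qubits with `k = 15` has `min (d^X, d^Z) ≤ 1` — the css-n16 value `1` is optimal among CSS codes because it is optimal among all additive codes (`noCode_16_15 : ¬ [[16,15,2]]`). [folklore] -/
theorem cssUpper_16_15 {RX RZ : Type*} [Fintype RX] [Fintype RZ] (C : CSSCode RX RZ (Fin 16)) (hk : C.k = 15) :
    min C.dX C.dZ ≤ 1 :=
  Nat.lt_succ_iff.1 (css_min_dX_dZ_lt_of_not_additiveCodeExists noCode_16_15 C hk)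

/-- Cell `(n, k) = (16, 16)`: every CSS code on `16` qubits with `k = 16` has `min (d^X, d^Z) ≤ 1` — the css-n16 value `1` is optimal among CSS codes because it is optimal among all additive codes (`noCode_16_16 : ¬ [[16,16,2]]`). [folklore] -/
theorem cssUpper_16_16 {RX RZ : Type*} [Fintype RX] [Fintype RZ] (C : CSSCode RX RZ (Fin 16)) (hk : C.k = 16) :
    min C.dX C.dZ ≤ 1 :=
  Nat.lt_succ_iff.1 (css_min_dX_dZ_lt_of_not_additiveCodeExists noCode_16_16 C hk)

end Summit.Ventures.QEC.Census.CSS
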